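import Summits.QuantumAdvantage.QuantumAdvantage.Theorems.LinnikCubicClassGroupsDegreeOnePrimesEscapeRayClassDHSmoothed
import Summits.QuantumAdvantage.QuantumAdvantage.Theorems.LinnikCubicClassGroupsDegreeOnePrimesEscapeClassPNTTheta
import Literature.NumberTheory.LFunctions.RayClassFiberUnsmoothing
import HarnessLib

/-!
# Linnik's theorem for cosets of a congruence class group, VI: the `θ_τ`-form of the Deuring–Heilbronn dichotomy

Topic `Summits/QuantumAdvantage/QuantumAdvantage/Theorems`, cell B2b-1 (linnik-cubic), PART A (gen 22); helper toward
the crux `DegreeOnePrimesEscape` (stmt-QuantumAdvantage-11543) of route `LinnikCubicClassGroups` — the ray-class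
counterpart of `…ClassPNTDHTheta`.  HONEST FRAMING: the value of this file is a THEOREM (kernel-checked, GRH-free) —
NOT summit progress.

`thetaFiber_dichotomy_dh`: for `n > 1`, density constants `b, D, a`, `η > 0` and a repulsion constant `c₁ ∈ (0,1]`
there are `a₂ ≥ 1`, `0 < c ≤ 1/(8(n²+1))` such that for every number field `K` of degree `n`, every abelian Frobenius
datum `f : 𝔭 ↦ f 𝔭 ∈ G` killing the narrow ray `mod 𝔪 ≠ 0` with non-trivial characters non-principal off `𝔪`, every
size parameter `Q ≥ Q_𝔪` with `|G| ≤ Q⁴`, the density bound in `Q`-form and the repulsion `c₁ Q^{−2} ≤ 1 − β₁` of the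
real zeros of the real members: EITHER `|θ_τ(x) − x/|G|| ≤ η x/|G|` for all `x ≥ Q^{a₂}` and all cosets `τ`, OR there
is a real `ψ₁` with a real zero `β₁ ∈ (1 − c/(log(|d_K|N𝔪) + log 4), 1)` of `F_{ψ₁}` and, with
`M_τ(x) = x − ψ₁(τ) x^{β₁}/β₁`, `|θ_τ(x) − M_τ(x)/|G|| ≤ η x min(1,(1−β₁) log x)/|G|`
(`θ_τ(x) = Σ_{N𝔭 ≤ x, 𝔭 ∤ 𝔪, f 𝔭 = τ} log N𝔭`, `fiberTheta`).  Unsmoothing by `RayClassFiberUnsmoothing` +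
`unsmoothing_error_le`.
References: A. Weiss, J. reine angew. Math. 338 (1983), Thm 5.2 [Weiss1983]; J. Thorner, A. Zaman, ANT 11 (2017),
Thm 3.1 [ThornerZaman2017]; ANT 13 (2019), Thm 1.4 [ThornerZaman2019].
-/

noncomputable section

open Complex Real Set Filter Topology NumberField IsDedekindDomain
open scoped NumberField nonZeroDivisors

namespace Summit.QuantumAdvantage.QuantumAdvantage.Theorems.DegreeOnePrimesEscape

open Literature.NumberTheory.LFunctions Literature.NumberTheory.LFunctions.NumberField
  Literature.NumberTheory.LFunctions.EntireEF Literature.NumberTheory.LFunctions.TZWeight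
  Literature.NumberTheory.LFunctions.AbelianDensity
open scoped Classical

/-! ### Real characters -/

/-- For a real character `ψ` (`ψ + ψ = 0`) of an abelian group: `ψ(a)⁻¹ = ψ(a)`, `ψ(a)` is real and
`|Re ψ(a)| ≤ 1` (`ψ(a)² = 1`). -/
theorem addChar_real_apply {A : Type*} [AddCommGroup A] {ψ : AddChar A ℂ} (hreal : ψ + ψ = 0) (a : A) :
    (ψ a)⁻¹ = ψ a ∧ (ψ a).im = 0 ∧ |(ψ a).re| ≤ 1 := by
  have hsq : ψ a * ψ a = 1 := by
    have := DFunLike.congr_fun hreal a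
    rwa [AddChar.add_apply, AddChar.zero_apply] at this
  have hpm : ψ a = 1 ∨ ψ a = -1 := sq_eq_one_iff.mp (by rw [sq]; exact hsq)
  refine ⟨?_, ?_, ?_⟩
  · rw [inv_eq_iff_eq_inv, eq_comm, inv_eq_of_mul_eq_one_right hsq]
  · rcases hpm with h | h <;> simp [h]
  · rcases hpm with h | h <;> simp [h]

/-! ### The `θ_τ`-form -/

set_option maxHeartbeats 1600000 in
/-- **The `θ_τ`-form of the Deuring–Heilbronn dichotomy for the cosets of a congruence class group** (see the
module docstring). [cite: Weiss1983, Theorem 5.2] [cite: ThornerZaman2017, Theorem 3.1] [cite: ThornerZaman2019, Theorem 1.4] -/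
theorem thetaFiber_dichotomy_dh (n : ℕ) (hn : 1 < n) {b D a : ℝ} (hb : 0 < b) (hD : 0 < D) (ha : 1 ≤ a)
    {η : ℝ} (hη : 0 < η) {c₁ : ℝ} (hc₁ : 0 < c₁) (hc₁1 : c₁ ≤ 1) :
    ∃ a₂ c : ℝ, 1 ≤ a₂ ∧ 0 < c ∧ c ≤ 1 / (8 * ((n : ℝ) ^ 2 + 1)) ∧
    ∀ (K : Type) [Field K] [NumberField K], Module.finrank ℚ K = n →
    ∀ (G : Type) [CommGroup G] [Finite G] (𝔪 : Ideal (𝓞 K)) (f : HeightOneSpectrum (𝓞 K) → G)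
      (h𝔪 : 𝔪 ≠ ⊥) (hray : ArtinKillsRay 𝔪 f)
      (hsep : ∀ χ : AddChar (Additive G) ℂ, χ ≠ 0 →
        ∃ v : HeightOneSpectrum (𝓞 K), ¬ 𝔪 ≤ v.asIdeal ∧ χ (Additive.ofMul (f v)) ≠ 1) (Q : ℝ),
      rayCondQ K 𝔪 ≤ Q → (Nat.card G : ℝ) ≤ Q ^ (4 : ℕ) →
      (∀ (T : ℝ), 1 ≤ T → ∀ u : AddChar (Additive G) ℂ → Finset ℂ,
        (∀ ψ, ∀ ρ ∈ u ψ, rayFamF h𝔪 hray hsep ψ ρ = 0 ∧ 1 / 4 ≤ ρ.re ∧ ρ.re < 1 ∧ |ρ.im| ≤ T) →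
        ∀ α : ℝ, α ≤ 1 →
          ∑ ψ, ∑ ρ ∈ u ψ with α ≤ ρ.re, (analyticOrderNatAt (rayFamF h𝔪 hray hsep ψ) ρ : ℝ) ≤
            D * Real.exp (b * (a * Real.log Q + Real.log (T + 4))) ^ (1 - α)) →
      (∀ ψ₁ : AddChar (Additive G) ℂ, ψ₁ + ψ₁ = 0 → ∀ β₁ : ℝ, β₁ < 1 →
        rayFamF h𝔪 hray hsep ψ₁ β₁ = 0 → c₁ * Q ^ (-(2 : ℝ)) ≤ 1 - β₁) →
      (∀ x : ℝ, Q ^ a₂ ≤ x → ∀ τ : G,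
          |fiberTheta 𝔪 f τ x - x / Nat.card G| ≤ η * x / Nat.card G) ∨
      ∃ (ψ₁ : AddChar (Additive G) ℂ) (β₁ : ℝ), rayFamF h𝔪 hray hsep ψ₁ β₁ = 0 ∧
          1 - c / (Real.log (((discr K).natAbs : ℝ) * ((Ideal.absNorm 𝔪 : ℕ) : ℝ)) + Real.log 4) < β₁ ∧ β₁ < 1 ∧
          ψ₁ + ψ₁ = 0 ∧
          ∀ x : ℝ, Q ^ a₂ ≤ x → ∀ τ : G,
            |fiberTheta 𝔪 f τ x - (x - (ψ₁ (Additive.ofMul τ)).re * x ^ β₁ / β₁) / Nat.card G| ≤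
              η * x * min 1 ((1 - β₁) * Real.log x) / Nat.card G := by
  have hη4 : 0 < η / 4 := by positivity
  obtain ⟨ν, a₁, c, hν0, hν64, ha₁1, hc, hcn, hmain⟩ := smoothedFiberSum_dichotomy_dh n hn hb hD ha hη4 hc₁ hc₁1
  set Λu : ℝ := max 0 (Real.log (176 * ((n : ℝ) + 1) / (ν * η * c₁))) with hΛu
  have hΛu0 : 0 ≤ Λu := le_max_left _ _
  set Λm : ℝ := max 0 (Real.log (64 / (η * c₁))) with hΛm
  have hΛm0 : 0 ≤ Λm := le_max_left _ _
  set a₂ : ℝ := max a₁ (max (2 * (Λu + 6) / ν) ((2 + Λm) / ν)) with ha₂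
  have ha₂a₁ : a₁ ≤ a₂ := le_max_left _ _
  have ha₂u : 2 * (Λu + 6) / ν ≤ a₂ := le_trans (le_max_left _ _) (le_max_right _ _)
  have ha₂m : (2 + Λm) / ν ≤ a₂ := le_trans (le_max_right _ _) (le_max_right _ _)
  have ha₂1 : 1 ≤ a₂ := le_trans ha₁1 ha₂a₁
  refine ⟨a₂, c, ha₂1, hc, hcn, fun K _ _ hKn G _ _ 𝔪 f h𝔪 hray hsep Q hQK hG hdens hrepul ↦ ?_⟩
  have hK : 1 < Module.finrank ℚ K := by rw [hKn]; exact hn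
  obtain ⟨hQ12, -, -, -, -, -, -⟩ := raySize_facts h𝔪 hK hQK
  have hQ1 : (1 : ℝ) < Q := by linarith
  have hQ0 : (0 : ℝ) < Q := by linarith
  have hlogQ : 2 ≤ Real.log Q := two_lt_log_twelve.le.trans (Real.log_le_log (by norm_num) hQ12)
  have hlogQ1 : 1 ≤ Real.log Q := by linarith
  set h : ℝ := (Nat.card G : ℝ) with hh
  have hh1 : 1 ≤ h := by
    rw [hh]; exact_mod_cast Nat.one_le_iff_ne_zero.2 (Nat.card_pos (α := G)).ne'
  have hh0 : 0 < h := by linarith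
  have hhQ : h ≤ Q ^ 4 := hG
  have hQm2 : Q ^ (-(2 : ℝ)) ≤ 1 := Real.rpow_le_one_of_one_le_of_nonpos hQ1.le (by norm_num)
  have hQm2' : 0 < Q ^ (-(2 : ℝ)) := Real.rpow_pos_of_pos hQ0 _
  set m' : ℝ := c₁ * Q ^ (-(2 : ℝ)) with hm'
  have hm'0 : 0 < m' := mul_pos hc₁ hQm2'
  have hm'1 : m' ≤ 1 := (mul_le_mul hc₁1 hQm2 hQm2'.le zero_le_one).trans (by norm_num)
  have hm'2 : m' = c₁ * (Q ^ 2)⁻¹ := by rw [hm', Real.rpow_neg hQ0.le, Real.rpow_two]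
  -- common estimates at `x ≥ Q^{a₂}`
  have hcommon : ∀ x : ℝ, Q ^ a₂ ≤ x → Q ^ a₁ ≤ x ∧ 1 < x ∧
      (∀ τ : G, h * |fiberTheta 𝔪 f τ x - smoothedPsiFiber 𝔪 f τ (tzTest (Real.log x) (x ^ (-ν)))| ≤
        η / 4 * x * m') ∧
      Real.sqrt x ≤ η / 64 * x * m' ∧ x ^ (-ν) * x ≤ η / 64 * x * m' ∧
      0 < x ^ (-ν) ∧ x ^ (-ν) ≤ 1 ∧ x ^ (-ν) < Real.log x / 2 ∧ 1 ≤ Real.log x := by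
    intro x hx
    have hxa₁ : Q ^ a₁ ≤ x := le_trans (Real.rpow_le_rpow_of_exponent_le hQ1.le ha₂a₁) hx
    have hxQ : Q ≤ x := by
      have : Q ^ (1 : ℝ) ≤ Q ^ a₂ := Real.rpow_le_rpow_of_exponent_le hQ1.le ha₂1
      rw [Real.rpow_one] at this; linarith
    have hx1 : 1 < x := by linarith
    have hx0 : 0 < x := by linarith
    set L : ℝ := Real.log x with hL
    have hLQ : a₂ * Real.log Q ≤ L := by
      have := Real.log_le_log (by positivity) hx
      rwa [Real.log_rpow (by linarith)] at this
    have hL2a : 2 * a₂ ≤ L := by nlinarith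
    have hL2 : 2 ≤ L := by linarith
    have hL0 : 0 < L := by linarith
    have hexpL : Real.exp L = x := by rw [hL, Real.exp_log hx0]
    set ε : ℝ := x ^ (-ν) with hε
    have hε0 : 0 < ε := Real.rpow_pos_of_pos hx0 _
    have hε1 : ε ≤ 1 := Real.rpow_le_one_of_one_le_of_nonpos hx1.le (by linarith)
    have hε1' : ε < 1 := Real.rpow_lt_one_of_one_lt_of_neg hx1 (by linarith)
    have hεL : ε < L / 2 := by linarith
    have hxe : Real.exp 1 ≤ x := by rw [← hexpL]; exact Real.exp_le_exp.2 (by linarith)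
    have hU : ∀ τ : G, h * |fiberTheta 𝔪 f τ x - smoothedPsiFiber 𝔪 f τ (tzTest L ε)| ≤ η / 4 * x * m' := by
      intro τ
      have h1 := (abs_fiberTheta_sub_smoothedPsiFiber_le (𝔪 := 𝔪) (f := f) τ hx1 hε0).trans
        (unsmoothing_error_le (K := K) hx1 hε0 hε1)
      rw [hKn] at h1
      have hlarge : 2 / ν * Real.log (44 * ((n : ℝ) * h + 1) / (ν * (η / 4 * m'))) ≤ L := by
        have hcmp : 44 * ((n : ℝ) * h + 1) / (ν * (η / 4 * m')) ≤
            (176 * ((n : ℝ) + 1) / (ν * η * c₁)) * Q ^ 6 := by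
          rw [hm'2, div_le_iff₀ (by positivity)]
          have hQ4 : 1 ≤ Q ^ 4 := one_le_pow₀ hQ1.le
          have hn0 : (0 : ℝ) ≤ n := Nat.cast_nonneg _
          have hnh : (n : ℝ) * h + 1 ≤ ((n : ℝ) + 1) * Q ^ 4 := by
            nlinarith [mul_le_mul_of_nonneg_left hhQ hn0]
          have e : 176 * ((n : ℝ) + 1) / (ν * η * c₁) * Q ^ 6 * (ν * (η / 4 * (c₁ * (Q ^ 2)⁻¹))) =
              44 * (((n : ℝ) + 1) * Q ^ 4) := by
            field_simp; ring
          rw [e]; nlinarith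
        have hlogle : Real.log (44 * ((n : ℝ) * h + 1) / (ν * (η / 4 * m'))) ≤ Λu + 6 * Real.log Q := by
          refine (Real.log_le_log (by positivity) hcmp).trans ?_
          rw [Real.log_mul (by positivity) (by positivity), Real.log_pow]
          push_cast
          linarith [le_max_right 0 (Real.log (176 * ((n : ℝ) + 1) / (ν * η * c₁)))]
        have h2ν : 0 < 2 / ν := by positivity
        calc 2 / ν * Real.log (44 * ((n : ℝ) * h + 1) / (ν * (η / 4 * m')))
            ≤ 2 / ν * (Λu + 6 * Real.log Q) := mul_le_mul_of_nonneg_left hlogle h2ν.le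
          _ ≤ 2 / ν * ((Λu + 6) * Real.log Q) := by
              refine mul_le_mul_of_nonneg_left ?_ h2ν.le
              nlinarith
          _ = 2 * (Λu + 6) / ν * Real.log Q := by ring
          _ ≤ a₂ * Real.log Q := mul_le_mul_of_nonneg_right ha₂u (by linarith)
          _ ≤ L := hLQ
      have hsmall := unsmoothing_small (n := (n : ℝ) * h) (ν := ν) (η := η / 4 * m') (t := x)
        (by positivity) hν0 (by linarith) (by positivity) hxe hlarge
      have e1 : (n : ℝ) * h * ((Real.log x + 1) * (8 * Real.sqrt x + 2 * x ^ (-ν) * x + 1)) =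
          h * ((n : ℝ) * ((Real.log x + 1) * (8 * Real.sqrt x + 2 * ε * x + 1))) := by rw [hε]; ring
      rw [e1] at hsmall
      have := mul_le_mul_of_nonneg_left h1 hh0.le
      linarith
    have hth := mul_rpow_neg_le_one_of_threshold (k := 2) (M := 64 / (η * c₁)) hQ12 hx hν0
      (by positivity) (by rw [← hΛm]; have := (div_le_iff₀ hν0).1 ha₂m; linarith)
    have hεm : ε ≤ η / 64 * m' := by
      rw [Real.rpow_two] at hth
      rw [hm'2, hε]
      have hMQ : 0 < 64 / (η * c₁) * Q ^ 2 := by positivity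
      have h1 : x ^ (-ν) ≤ 1 / (64 / (η * c₁) * Q ^ 2) := by
        rw [le_div_iff₀ hMQ, mul_comm]; exact hth
      have h2 : 1 / (64 / (η * c₁) * Q ^ 2) = η / 64 * (c₁ * (Q ^ 2)⁻¹) := by
        field_simp
      rw [← h2]; exact h1
    have hεx : ε * x ≤ η / 64 * x * m' := by
      have := mul_le_mul_of_nonneg_right hεm hx0.le; linarith
    have hsqrt : Real.sqrt x ≤ η / 64 * x * m' := by
      have h1 : Real.sqrt x = x ^ (-(1 / 2 : ℝ)) * x := by
        rw [Real.sqrt_eq_rpow, show (-(1 / 2 : ℝ)) = 1 / 2 - 1 by norm_num, Real.rpow_sub hx0,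
          Real.rpow_one]
        field_simp
      have h2 : x ^ (-(1 / 2 : ℝ)) ≤ ε := Real.rpow_le_rpow_of_exponent_le hx1.le (by linarith)
      rw [h1]
      have := mul_le_mul_of_nonneg_right (h2.trans hεm) hx0.le
      linarith
    exact ⟨hxa₁, hx1, hU, hsqrt, hεx, hε0, hε1, hεL, by linarith⟩
  rcases hmain K hKn G 𝔪 f h𝔪 hray hsep Q hQK hG hdens hrepul with hgood | ⟨ψ₁, β₁, hz, hβlow, hβ1, hreal, hexc⟩
  · -- no exceptional zero
    left
    intro x hx τ
    obtain ⟨hxa₁, hx1, hU, hsqrt, hεx, hε0, hε1, hεL, -⟩ := hcommon x hx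
    have hx0 : 0 < x := by linarith
    have h1 := hgood x hxa₁ τ
    have h1' := (Complex.abs_re_le_norm _).trans h1
    simp only [Complex.sub_re, Complex.mul_re, Complex.natCast_re, Complex.natCast_im,
      Complex.ofReal_re, Complex.ofReal_im, mul_zero, sub_zero] at h1'
    have h2 := abs_re_fordLaplace_tzTest_neg_one_sub_le hx1 hε0 hε1 hεL
    have h3 := hU τ
    have hm'x : η / 4 * x * m' ≤ η / 4 * x := by
      have := mul_le_mul_of_nonneg_left hm'1 (by positivity : (0 : ℝ) ≤ η / 4 * x); linarith
    have hkey : |h * fiberTheta 𝔪 f τ x - x| ≤ η * x := by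
      have hD : |h * (fiberTheta 𝔪 f τ x - smoothedPsiFiber 𝔪 f τ (tzTest (Real.log x) (x ^ (-ν))))| ≤
          η / 4 * x := by
        rw [abs_mul, abs_of_pos hh0]; exact (h3.trans hm'x)
      have hD' := abs_le.1 hD
      rw [abs_le] at h1' h2 ⊢
      rw [← hh] at h1'
      have hηx : 0 < η * x := mul_pos hη hx0
      have hsx : Real.sqrt x ≤ η / 64 * x := hsqrt.trans (by
        have := mul_le_mul_of_nonneg_left hm'1 (by positivity : (0 : ℝ) ≤ η / 64 * x); linarith)
      have hex : x ^ (-ν) * x ≤ η / 64 * x := hεx.trans (by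
        have := mul_le_mul_of_nonneg_left hm'1 (by positivity : (0 : ℝ) ≤ η / 64 * x); linarith)
      constructor <;> nlinarith [hD'.1, hD'.2, h1'.1, h1'.2, h2.1, h2.2, hsx, hex]
    have e : fiberTheta 𝔪 f τ x - x / h = (h * fiberTheta 𝔪 f τ x - x) / h := by
      field_simp
    rw [e, abs_div, abs_of_pos hh0, div_le_div_iff_of_pos_right hh0]
    exact hkey
  · -- the exceptional zero
    right
    have hδlow : m' ≤ 1 - β₁ := hrepul ψ₁ hreal β₁ hβ1 hz
    have hβhalf : 1 / 2 ≤ β₁ := by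
      have hlog4 : 1 < Real.log 4 := by
        rw [show (4:ℝ) = 2 ^ 2 by norm_num, Real.log_pow]; have := Real.log_two_gt_d9; push_cast; linarith
      have hlogd : 0 ≤ Real.log (((discr K).natAbs : ℝ) * ((Ideal.absNorm 𝔪 : ℕ) : ℝ)) :=
        Real.log_nonneg (one_le_discr_mul_absNorm K h𝔪)
      have hc2 : c ≤ 1 / 2 :=
        hcn.trans (by rw [div_le_div_iff_of_pos_left one_pos (by positivity) (by norm_num)]; nlinarith)
      have : c / (Real.log (((discr K).natAbs : ℝ) * ((Ideal.absNorm 𝔪 : ℕ) : ℝ)) + Real.log 4) ≤ 1 / 2 := by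
        rw [div_le_iff₀ (by linarith)]; nlinarith
      linarith
    refine ⟨ψ₁, β₁, hz, hβlow, hβ1, hreal, fun x hx τ ↦ ?_⟩
    obtain ⟨hxa₁, hx1, hU, hsqrt, hεx, hε0, hε1, hεL, hL1⟩ := hcommon x hx
    have hx0 : 0 < x := by linarith
    set m : ℝ := min 1 ((1 - β₁) * Real.log x) with hmdef
    have hδm : 1 - β₁ ≤ (1 - β₁) * Real.log x := by
      have := mul_le_mul_of_nonneg_left hL1 (by linarith : (0 : ℝ) ≤ 1 - β₁); linarith
    have hm'm : m' ≤ m := le_min hm'1 (hδlow.trans hδm)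
    have hm0 : 0 ≤ m := hm'0.le.trans hm'm
    have h1 := hexc x hxa₁ τ
    have h1' := (Complex.abs_re_le_norm _).trans h1
    have hFreal : (fordLaplace (tzTest (Real.log x) (x ^ (-ν))) (-(β₁ : ℂ))).im = 0 := by
      rw [fordLaplace_tzTest_ofReal (Real.log_pos hx1) hε0 β₁, Complex.ofReal_im]
    obtain ⟨hψinv, hψim, hψre⟩ := addChar_real_apply hreal (Additive.ofMul τ)
    rw [hψinv] at h1'
    simp only [Complex.add_re, Complex.sub_re, Complex.mul_re, Complex.natCast_re, Complex.natCast_im,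
      Complex.ofReal_re, Complex.ofReal_im, mul_zero, sub_zero, hFreal, hψim] at h1'
    have h2 := abs_re_fordLaplace_tzTest_neg_one_sub_le hx1 hε0 hε1 hεL
    have h4 := abs_re_fordLaplace_tzTest_neg_sub_le hx1 hε0 hε1 hεL hβhalf hβ1.le
    have h3 := hU τ
    have h3m : h * |fiberTheta 𝔪 f τ x - smoothedPsiFiber 𝔪 f τ (tzTest (Real.log x) (x ^ (-ν)))| ≤
        η / 4 * x * m := h3.trans (mul_le_mul_of_nonneg_left hm'm (by positivity))
    have hsqrtm : Real.sqrt x ≤ η / 64 * x * m := hsqrt.trans (mul_le_mul_of_nonneg_left hm'm (by positivity))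
    have hεxm : x ^ (-ν) * x ≤ η / 64 * x * m := hεx.trans (mul_le_mul_of_nonneg_left hm'm (by positivity))
    set r : ℝ := (ψ₁ (Additive.ofMul τ)).re with hr
    set mt : ℝ := x ^ β₁ / β₁ with hmtdef
    have hkey : |h * fiberTheta 𝔪 f τ x - (x - r * mt)| ≤ η * x * m := by
      have hD : |h * (fiberTheta 𝔪 f τ x - smoothedPsiFiber 𝔪 f τ (tzTest (Real.log x) (x ^ (-ν))))| ≤
          η / 4 * x * m := by
        rw [abs_mul, abs_of_pos hh0]; exact h3m
      have hD' := abs_le.1 hD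
      rw [← hh] at h1'
      set Fβ : ℝ := (fordLaplace (tzTest (Real.log x) (x ^ (-ν))) (-(β₁ : ℂ))).re with hFβ
      have hprod : |r * Fβ - r * mt| ≤ 2 * Real.sqrt x + 4 * x ^ (-ν) * x := by
        rw [← mul_sub, abs_mul]
        calc |r| * |Fβ - mt| ≤ 1 * (2 * Real.sqrt x + 4 * x ^ (-ν) * x) :=
              mul_le_mul hψre h4 (abs_nonneg _) zero_le_one
          _ = _ := one_mul _
      have hprod' := abs_le.1 hprod
      rw [abs_le] at h1' h2 ⊢
      have hηxm : 0 ≤ η * x * m := by positivity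
      constructor <;> linarith [hD'.1, hD'.2, h1'.1, h1'.2, h2.1, h2.2, hprod'.1, hprod'.2, hsqrtm, hεxm]
    rw [hmtdef] at hkey
    have e : fiberTheta 𝔪 f τ x - (x - r * x ^ β₁ / β₁) / h =
        (h * fiberTheta 𝔪 f τ x - (x - r * (x ^ β₁ / β₁))) / h := by
      field_simp
    rw [e, abs_div, abs_of_pos hh0, div_le_div_iff_of_pos_right hh0]
    exact hkey

end Summit.QuantumAdvantage.QuantumAdvantage.Theorems.DegreeOnePrimesEscape

end
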